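import Mathlib

/-!
# Crux `LevyNegativeMoment` (stmt-AtomisticToContinuum-9115), line `registered`, stub `stub_rieszSum` —
# part E: max-norm domination of radial sums over `(ℤ/m)²`

Helper file (lead prover of the line) for the L-free grid Riesz sum bound (stub `stub_rieszSum`).  After the
coordinate split, the one-dimensional bounds of part D depend on the transverse frequency `p ∈ (ℤ/m)²` only
through an antitone function of `ρ_p = ‖p̄‖ ≥ max(p̄₀, p̄₁)`.  Sums of such functions are dominated by
one-dimensional sums via the sup-norm level sets:

* `card_filter_bar_le`: `#{b ∈ ℤ/m : b̄ ≤ u} ≤ 2u + 1`, and `card_filter_bar_eq_le_two`: `#{a : ā = u} ≤ 2`;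
* `sum_pi_two_le`: for `Φ ≥ 0` on `ℕ`,
  `Σ_{p : Fin 2 → Fin m} Φ(max(p̄₀, p̄₁)) ≤ 4 Σ_{u ≤ m/2} (2u+1) Φ(u)`.
-/

namespace Summit.AtomisticToContinuum.BoseEinsteinCondensation.Cruxes.LevyNegativeMoment.Birth.Riesz

open scoped BigOperators
open Finset

/-- `#{b ∈ ℤ/m : b̄ ≤ u} ≤ 2u + 1` (`b̄ = min(b, m-b)`). [folklore] -/
theorem card_filter_bar_le (m u : ℕ) :
    ((univ : Finset (Fin m)).filter (fun b : Fin m => min (b : ℕ) (m - (b : ℕ)) ≤ u)).card ≤ 2 * u + 1 := by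
  -- the set is contained in the image of `range (u+1) ∪ Ico (m-u) m` under `Fin` casting; count via values
  have key : ((univ : Finset (Fin m)).filter (fun b : Fin m => min (b : ℕ) (m - (b : ℕ)) ≤ u)).card
      ≤ ((range (u + 1) ∪ Ico (m - u) m)).card := by
    rw [← card_image_of_injective _ Fin.val_injective]
    apply card_le_card
    intro x hx
    simp only [mem_image, mem_filter, mem_univ, true_and] at hx
    obtain ⟨b, hb, rfl⟩ := hx
    simp only [mem_union, mem_range, mem_Ico]
    have := b.isLt
    omega
  refine key.trans ((card_union_le _ _).trans ?_)
  simp only [card_range, Nat.card_Ico]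
  omega

/-- `#{a ∈ ℤ/m : ā = u} ≤ 2`. [folklore] -/
theorem card_filter_bar_eq_le_two (m u : ℕ) :
    ((range m).filter (fun a => min a (m - a) = u)).card ≤ 2 := by
  have hsub : (range m).filter (fun a => min a (m - a) = u) ⊆ {u, m - u} := by
    intro a ha
    simp only [mem_filter, mem_range] at ha
    simp only [mem_insert, mem_singleton]
    omega
  exact (card_le_card hsub).trans card_le_two

/-- One coordinate: `Σ_{a : Fin m} Ψ(ā) ≤ 2 Σ_{u ≤ m/2} Ψ(u)` for `Ψ ≥ 0`. [folklore] -/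
theorem sum_fin_bar_le {m : ℕ} {Ψ : ℕ → ℝ} (hΨ : ∀ u, 0 ≤ Ψ u) :
    ∑ a : Fin m, Ψ (min (a : ℕ) (m - a)) ≤ 2 * ∑ u ∈ range (m / 2 + 1), Ψ u := by
  rw [Fin.sum_univ_eq_sum_range (fun a => Ψ (min a (m - a))) m]
  have hmaps : ∀ a ∈ range m, min a (m - a) ∈ range (m / 2 + 1) := by
    intro a ha
    simp only [mem_range] at ha ⊢
    omega
  rw [← sum_fiberwise_of_maps_to hmaps (fun a => Ψ (min a (m - a))), mul_sum]
  refine sum_le_sum fun u _ => ?_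
  have : ∑ a ∈ range m with min a (m - a) = u, Ψ (min a (m - a))
      = ∑ a ∈ range m with min a (m - a) = u, Ψ u :=
    sum_congr rfl fun a ha => by rw [(mem_filter.mp ha).2]
  rw [this, sum_const, nsmul_eq_mul]
  have hc : (((range m).filter (fun a => min a (m - a) = u)).card : ℝ) ≤ 2 := by
    exact_mod_cast card_filter_bar_eq_le_two m u
  exact mul_le_mul_of_nonneg_right hc (hΨ u)

/-- **Max-norm domination.** For `Φ ≥ 0` on `ℕ`:
`Σ_{p : Fin 2 → Fin m} Φ(max(p̄₀, p̄₁)) ≤ 4 Σ_{u ≤ m/2} (2u+1) Φ(u)`. [folklore] -/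
theorem sum_pi_two_le {m : ℕ} {Φ : ℕ → ℝ} (hΦ0 : ∀ u, 0 ≤ Φ u) :
    ∑ p : Fin 2 → Fin m, Φ (max (min (p 0 : ℕ) (m - p 0)) (min (p 1 : ℕ) (m - p 1))) ≤
      4 * ∑ u ∈ range (m / 2 + 1), (2 * u + 1) * Φ u := by
  -- pass to Fin m × Fin m
  rw [← Equiv.sum_comp (piFinTwoEquiv (fun _ : Fin 2 => Fin m)).symm]
  simp only [piFinTwoEquiv_symm_apply, Fin.cons_zero, Fin.cons_one]
  rw [Fintype.sum_prod_type]
  simp only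
  -- pointwise domination Φ(max(x,y)) ≤ Φ x · [y ≤ x] + Φ y · [x ≤ y]
  have hpt : ∀ a b : Fin m,
      Φ (max (min (a : ℕ) (m - a)) (min (b : ℕ) (m - b)))
        ≤ (if min (b : ℕ) (m - b) ≤ min (a : ℕ) (m - a) then Φ (min (a : ℕ) (m - a)) else 0)
          + (if min (a : ℕ) (m - a) ≤ min (b : ℕ) (m - b) then Φ (min (b : ℕ) (m - b)) else 0) := by
    intro a b
    rcases le_total (min (b : ℕ) (m - b)) (min (a : ℕ) (m - a)) with h | h
    · rw [max_eq_left h, if_pos h]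
      split_ifs
      · linarith [hΦ0 (min (b : ℕ) (m - b))]
      · linarith
    · rw [max_eq_right h, if_pos h]
      split_ifs
      · linarith [hΦ0 (min (a : ℕ) (m - a))]
      · linarith
  have step1 : ∑ a : Fin m, ∑ b : Fin m, Φ (max (min (a : ℕ) (m - a)) (min (b : ℕ) (m - b)))
      ≤ ∑ a : Fin m, ∑ b : Fin m,
          ((if min (b : ℕ) (m - b) ≤ min (a : ℕ) (m - a) then Φ (min (a : ℕ) (m - a)) else 0)
          + (if min (a : ℕ) (m - a) ≤ min (b : ℕ) (m - b) then Φ (min (b : ℕ) (m - b)) else 0)) :=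
    sum_le_sum fun a _ => sum_le_sum fun b _ => hpt a b
  refine step1.trans ?_
  rw [show (4 : ℝ) * ∑ u ∈ range (m / 2 + 1), (2 * u + 1) * Φ u
      = 2 * ∑ u ∈ range (m / 2 + 1), (2 * u + 1) * Φ u + 2 * ∑ u ∈ range (m / 2 + 1), (2 * u + 1) * Φ u
      by ring]
  simp only [sum_add_distrib]
  -- the two pieces are equal by symmetry; bound each
  have piece : ∀ (a : Fin m), ∑ b : Fin m,
      (if min (b : ℕ) (m - b) ≤ min (a : ℕ) (m - a) then Φ (min (a : ℕ) (m - a)) else 0)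
        ≤ (2 * (min (a : ℕ) (m - a) : ℕ) + 1) * Φ (min (a : ℕ) (m - a)) := by
    intro a
    rw [← sum_filter, sum_const, nsmul_eq_mul]
    gcongr
    · exact hΦ0 _
    · exact_mod_cast card_filter_bar_le m (min (a : ℕ) (m - a))
  have hA : ∑ a : Fin m, ∑ b : Fin m,
      (if min (b : ℕ) (m - b) ≤ min (a : ℕ) (m - a) then Φ (min (a : ℕ) (m - a)) else 0)
        ≤ 2 * ∑ u ∈ range (m / 2 + 1), (2 * u + 1) * Φ u := by
    calc _ ≤ ∑ a : Fin m, (2 * (min (a : ℕ) (m - a) : ℕ) + 1) * Φ (min (a : ℕ) (m - a)) :=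
          sum_le_sum fun a _ => piece a
      _ ≤ 2 * ∑ u ∈ range (m / 2 + 1), (2 * u + 1) * Φ u := by
          have := sum_fin_bar_le (m := m) (Ψ := fun u => (2 * (u : ℕ) + 1 : ℝ) * Φ u)
            (fun u => by positivity [hΦ0 u])
          exact_mod_cast this
  have hB : ∑ a : Fin m, ∑ b : Fin m,
      (if min (a : ℕ) (m - a) ≤ min (b : ℕ) (m - b) then Φ (min (b : ℕ) (m - b)) else 0)
        ≤ 2 * ∑ u ∈ range (m / 2 + 1), (2 * u + 1) * Φ u := by
    rw [sum_comm]
    exact (sum_le_sum fun b _ => piece b).trans (by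
      have := sum_fin_bar_le (m := m) (Ψ := fun u => (2 * (u : ℕ) + 1 : ℝ) * Φ u)
        (fun u => by positivity [hΦ0 u])
      exact_mod_cast this)
  exact add_le_add hA hB

end Summit.AtomisticToContinuum.BoseEinsteinCondensation.Cruxes.LevyNegativeMoment.Birth.Riesz
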